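import Mathlib.RingTheory.Ideal.GoingUp
import Mathlib.RingTheory.KrullDimension.Zero
import Mathlib.RingTheory.Localization.AtPrime.Basic
import Literature.RingTheory.TightClosure.TightClosure
import Summits.ResolutionOfSingularities.ResolutionOfSingularities.Theorems.FrobeniusLadderFInjectiveMacaulayficationDegreeZeroDescentLocal
import HarnessLib

/-!
# Finite descent of the clause along a retraction (E4, module-finite / integral case)

Support file for crux stmt-ResolutionOfSingularities-15315 (`FrobeniusLadder.FInjectiveMacaulayfication`,
line `Sketch`, §15 the weighted cone engine): stub `stub_finiteGradedDescent`.

Setting: `A ⊆ B` a `k`-subalgebra of a Noetherian ring `B` of prime characteristic `p`, with `B` integral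
over `A` and an `A`-linear retraction `ρ : B → A`; `b ∈ B` with `b ^ N ∈ A`. If every local ring `B_Q` at a
maximal ideal `Q ∋ b` satisfies the crux's per-stalk clause (every system of parameters is weakly regular
and generates a Frobenius-closed ideal), and all local rings of `A` and of `B` at maximal ideals have the
same dimension `m`, then `A_𝔫` satisfies the clause at every maximal ideal `𝔫 ∋ b ^ N`.

Proof: `DegreeZeroDescent.inlineClause_localization_of_retract` (degree-zero descent, localized form) with
`e = 0`. For a prime `Q` of `B` maximal among those with `Q ∩ A ⊆ 𝔫`, going up
(`Ideal.exists_ideal_over_prime_of_isIntegral_of_isPrime`) gives `Q ∩ A = 𝔫`, so `Q` is a maximal ideal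
(`Ideal.isMaximal_of_isIntegral_of_isMaximal_comap`) containing `b` (as `b ^ N ∈ Q`). The induced map
`ψ : A_𝔫 → B_Q` is `Localization.localRingHom`, a local homomorphism, so a system of parameters `s` of
`A_𝔫` maps into `Q B_Q`; and every prime of `B_Q` containing `ψ(s)` pulls back to the maximal ideal of
`A_𝔫`, hence contracts to a maximal ideal of `B` inside `Q`, i.e. equals `Q B_Q`: the quotient
`B_Q ⧸ (ψ s)` is zero-dimensional. No new definitions; everything is folklore commutative algebra on top of
Mathlib's going-up.
-/

-- single-problem summit: the doubled namespace component is forced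
set_option linter.dupNamespace false

namespace Summit.ResolutionOfSingularities.ResolutionOfSingularities.Theorems.FInjectiveMacaulayfication.FiniteGradedDescent

open IsLocalRing RingTheory.Sequence Literature.RingTheory.TightClosure

/-- In an integral extension `A → B`, a prime `Q` of `B` that is maximal among the primes contracting
into a maximal ideal `𝔫` of `A` contracts exactly to `𝔫` (going up). [folklore] -/
theorem comap_eq_of_maximal_among {A B : Type*} [CommRing A] [CommRing B] [Algebra A B]
    [Algebra.IsIntegral A B] (𝔫 : Ideal A) [𝔫.IsMaximal] (Q : Ideal B) [Q.IsPrime]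
    (hQn : Q.comap (algebraMap A B) ≤ 𝔫)
    (hQmax : ∀ Q' : Ideal B, Q'.IsPrime → Q ≤ Q' → Q'.comap (algebraMap A B) ≤ 𝔫 → Q' ≤ Q) :
    Q.comap (algebraMap A B) = 𝔫 := by
  obtain ⟨Q', hQQ', hQ'prime, hQ'comap⟩ :=
    Ideal.exists_ideal_over_prime_of_isIntegral_of_isPrime 𝔫 Q hQn
  have hle : Q' ≤ Q := hQmax Q' hQ'prime hQQ' hQ'comap.le
  rw [← hQ'comap, le_antisymm hle hQQ']

/-- In an integral extension `A → B` with `𝔫` a maximal ideal of `A` and `Q` a prime of `B`, a prime `P`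
of `B_Q` whose preimage under a map `ψ : A_𝔫 → B_Q` compatible with the structure maps is the maximal
ideal of `A_𝔫` is the maximal ideal of `B_Q` (its contraction to `B` lies over `𝔫`, so is a maximal ideal
inside `Q`). [folklore] -/
theorem eq_maximalIdeal_of_comap_eq {A B : Type*} [CommRing A] [CommRing B] [Algebra A B]
    [Algebra.IsIntegral A B] (𝔫 : Ideal A) [𝔫.IsMaximal] (Q : Ideal B) [Q.IsPrime]
    (ψ : Localization.AtPrime 𝔫 →+* Localization.AtPrime Q)
    (hψ : ψ.comp (algebraMap A (Localization.AtPrime 𝔫)) =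
      (algebraMap B (Localization.AtPrime Q)).comp (algebraMap A B))
    (P : Ideal (Localization.AtPrime Q)) [P.IsPrime]
    (hP : P.comap ψ = maximalIdeal (Localization.AtPrime 𝔫)) :
    P = maximalIdeal (Localization.AtPrime Q) := by
  set Q₀ : Ideal B := P.under B with hQ₀
  have hQ₀A : Q₀.comap (algebraMap A B) = 𝔫 := by
    rw [hQ₀, Ideal.under, Ideal.comap_comap, ← hψ, ← Ideal.comap_comap, hP]
    exact Localization.AtPrime.under_maximalIdeal
  have hQ₀Amax : (Q₀.comap (algebraMap A B)).IsMaximal := by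
    rw [hQ₀A]
    infer_instance
  haveI : Q₀.IsMaximal := Ideal.isMaximal_of_isIntegral_of_isMaximal_comap Q₀ hQ₀Amax
  have hQ₀Q : Q₀ ≤ Q := by
    have h := Ideal.comap_mono (f := algebraMap B (Localization.AtPrime Q))
      (IsLocalRing.le_maximalIdeal (Ideal.IsPrime.ne_top inferInstance : P ≠ ⊤))
    rwa [show (maximalIdeal (Localization.AtPrime Q)).comap (algebraMap B (Localization.AtPrime Q)) = Q
      from Localization.AtPrime.under_maximalIdeal] at h
  have hQ₀eq : Q₀ = Q := Ideal.IsMaximal.eq_of_le inferInstance (Ideal.IsPrime.ne_top inferInstance) hQ₀Q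
  exact Localization.AtPrime.eq_maximalIdeal_iff_under_eq.mp hQ₀eq

/-- **FINITE DESCENT OF THE CLAUSE ALONG A RETRACTION** (E4 in the finite case): `A ⊆ B` a `k`-subalgebra of a
Noetherian ring of characteristic `p` with `B` integral over `A` and an `A`-linear retraction `B → A`; if all local
rings of `B` at maximal ideals containing `b` have dimension `m` and satisfy the clause, and all local rings of `A` at
maximal ideals have dimension `m`, then `A_𝔫` satisfies the clause at every maximal `𝔫 ∋ b^N` (`b^N ∈ A`). The primes of
`B` maximal among those contracting into `𝔫` are the maximal ideals over `𝔫` (going up), the image of a system of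
parameters of `A_𝔫` generates a `Q B_Q`-primary ideal, and `DegreeZeroDescent.inlineClause_localization_of_retract`
applies with `e = 0`. [folklore] -/
theorem stub_finiteGradedDescent : ∀ (p : ℕ) [Fact p.Prime] (k B : Type) [Field k] [CommRing B] [Algebra k B]
    [IsNoetherianRing B] [CharP B p] (A : Subalgebra k B) [Algebra.IsIntegral A B]
    (ρ : B →ₗ[A] A), (∀ x : A, ρ (x : B) = x) → ∀ (b : B) (N m : ℕ) (hbN : b ^ N ∈ A),
    (∀ (Q : Ideal B) [Q.IsMaximal], ringKrullDim (Localization.AtPrime Q) = m) →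
    (∀ (𝔫 : Ideal A) [𝔫.IsMaximal], ringKrullDim (Localization.AtPrime 𝔫) = m) →
    (∀ (Q : Ideal B) [Q.IsMaximal], b ∈ Q →
      ∀ d : ℕ, ringKrullDim (Localization.AtPrime Q) = d → ∀ s : Fin d → Localization.AtPrime Q,
        (Ideal.span (Set.range s)).radical.IsMaximal →
          RingTheory.Sequence.IsWeaklyRegular (Localization.AtPrime Q) (List.ofFn s) ∧
          ∀ y : Localization.AtPrime Q, (∃ e : ℕ, y ^ p ^ e ∈ Ideal.span
            ((fun z : Localization.AtPrime Q => z ^ p ^ e) ''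
              (Ideal.span (Set.range s) : Set (Localization.AtPrime Q)))) → y ∈ Ideal.span (Set.range s)) →
    ∀ (𝔫 : Ideal A) [𝔫.IsMaximal], (⟨b ^ N, hbN⟩ : A) ∈ 𝔫 →
      ∀ d : ℕ, ringKrullDim (Localization.AtPrime 𝔫) = d → ∀ s : Fin d → Localization.AtPrime 𝔫,
        (Ideal.span (Set.range s)).radical.IsMaximal →
          RingTheory.Sequence.IsWeaklyRegular (Localization.AtPrime 𝔫) (List.ofFn s) ∧
          ∀ y : Localization.AtPrime 𝔫, (∃ e : ℕ, y ^ p ^ e ∈ Ideal.span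
            ((fun z : Localization.AtPrime 𝔫 => z ^ p ^ e) ''
              (Ideal.span (Set.range s) : Set (Localization.AtPrime 𝔫)))) → y ∈ Ideal.span (Set.range s) := by
  intro p _ k B _ _ _ _ _ A _ ρ hρ b N m hbN hdimB hdimA hclB 𝔫 _ hb𝔫
  have hρ1 : ρ 1 = 1 := by simpa using hρ 1
  have hinj : Function.Injective (algebraMap A B) := Subtype.val_injective
  haveI : CharP A p := (algebraMap A B).charP hinj p
  haveI : IsNoetherianRing A := DegreeZeroDescent.isNoetherianRing_of_retract ρ hρ1
  refine DegreeZeroDescent.inlineClause_localization_of_retract p ρ hρ1 𝔫 ?_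
  intro d s hs Q _ hQn hQmax ψ hψ
  -- `Q ∩ A = 𝔫`, so `Q` is a maximal ideal of `B` containing `b`
  have hQeq : Q.comap (algebraMap A B) = 𝔫 := comap_eq_of_maximal_among 𝔫 Q hQn hQmax
  have hQAmax : (Q.comap (algebraMap A B)).IsMaximal := by
    rw [hQeq]
    infer_instance
  haveI hQm : Q.IsMaximal := Ideal.isMaximal_of_isIntegral_of_isMaximal_comap Q hQAmax
  have hbQ : b ∈ Q := by
    have h1 : algebraMap A B ⟨b ^ N, hbN⟩ ∈ Q := by
      rw [← Ideal.mem_comap, hQeq]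
      exact hb𝔫
    exact Ideal.IsPrime.mem_of_pow_mem inferInstance N h1
  -- `ψ` is the canonical local homomorphism `A_𝔫 → B_Q`
  have hψeq : Localization.localRingHom 𝔫 Q (algebraMap A B) hQeq.symm = ψ :=
    Localization.localRingHom_unique _ _ _ _ fun x => by
      have := RingHom.congr_fun hψ x
      simpa using this
  have hsmax : ∀ i, s i ∈ maximalIdeal (Localization.AtPrime 𝔫) := fun i =>
    hs.2 ▸ Ideal.le_radical (Ideal.subset_span ⟨i, rfl⟩)
  have hψloc : ∀ i, ψ (s i) ∈ maximalIdeal (Localization.AtPrime Q) := fun i => by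
    rw [← hψeq]
    exact map_nonunit _ _ (hsmax i)
  refine ⟨fun _ => ⟨hclB Q hbQ, 0, ?_, ?_⟩, fun ⟨i, hi⟩ => absurd (hψloc i) hi⟩
  · -- `dim B_Q = m = d`
    have hdm : (d : WithBot ℕ∞) = m := hs.1.symm.trans (hdimA 𝔫)
    rw [Nat.add_zero, hdm]
    exact hdimB Q
  · -- `B_Q ⧸ (ψ s)` is zero-dimensional: its only prime is the maximal ideal
    set J : Ideal (Localization.AtPrime Q) := Ideal.span (Set.range fun i => ψ (s i)) with hJ
    have hJle : J ≤ maximalIdeal (Localization.AtPrime Q) := by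
      rw [hJ, Ideal.span_le]
      rintro _ ⟨i, rfl⟩
      exact hψloc i
    have hJne : J ≠ ⊤ := fun h => (maximalIdeal.isMaximal _).ne_top (top_le_iff.mp (h ▸ hJle))
    haveI : Nontrivial (Localization.AtPrime Q ⧸ J) := Ideal.Quotient.nontrivial_iff.mpr hJne
    have hprime : ∀ P : Ideal (Localization.AtPrime Q), P.IsPrime → J ≤ P →
        P = maximalIdeal (Localization.AtPrime Q) := by
      intro P hP hJP
      haveI := hP
      refine eq_maximalIdeal_of_comap_eq 𝔫 Q ψ hψ P ?_
      have hsP : Ideal.span (Set.range s) ≤ P.comap ψ := by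
        rw [Ideal.span_le]
        rintro _ ⟨i, rfl⟩
        exact hJP (Ideal.subset_span ⟨i, rfl⟩)
      have hmP : maximalIdeal (Localization.AtPrime 𝔫) ≤ P.comap ψ := by
        rw [← hs.2]
        exact (Ideal.IsPrime.radical_le_iff inferInstance).mpr hsP
      exact ((maximalIdeal.isMaximal _).eq_of_le (Ideal.IsPrime.ne_top inferInstance) hmP).symm
    haveI : Ring.KrullDimLE 0 (Localization.AtPrime Q ⧸ J) := by
      refine Ideal.krullDimLE_zero_quotient_iff_forall_minimalPrimes_isMaximal.mpr fun P hP => ?_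
      rw [hprime P hP.1.1 hP.1.2]
      exact maximalIdeal.isMaximal _
    rw [Nat.cast_zero]
    exact ringKrullDimZero_iff_ringKrullDim_eq_zero.mp inferInstance

end Summit.ResolutionOfSingularities.ResolutionOfSingularities.Theorems.FInjectiveMacaulayfication.FiniteGradedDescent
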